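import Literature.MathematicalPhysics.StatisticalMechanics.HcpFccLatticeSumsRegistry
import Literature.MathematicalPhysics.StatisticalMechanics.HcpFccLatticeSumsLayers

/-!
# Certified hcp/fcc lattice sums: the families at the ideal ratio `c² = 2/3`, truncated

Specialisation of `…Layers.lean` and `…Registry.lean` to `c² = 2/3` (`s_k = 2k²/3`):
the signed registry family `g⁽ⁿ⁾(k) = ([3 ∤ k] − [2 ∤ k]) J⁽ⁿ⁾(2k²/3)` is even with `g(0) = 0` and
`|g⁽³⁾(k)| ≤ (3106/25) k⁻⁶` (`k ≥ 41`), `|g⁽⁶⁾(k)| ≤ 1291 k⁻¹²` (`k ≥ 13`), whence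

* `hcp_sub_fcc_three_trunc`: `|D₃ − 2∑_{k=1}^{40} g⁽³⁾(k)| ≤ 2·(3106/25)(1/5)40⁻⁵` and
  `hcp_sub_fcc_six_trunc` (`K = 12`), `D_n = hcpInvPowSum n √(2/3) − fccInvPowSum n √(2/3)`;
* `hcpInvPowSum_three_trunc` / `_six_trunc`: two-sided truncations of the hcp sums themselves by
  their layers `k ≤ 16` resp. `k ≤ 6` (nonnegative tails, majorants `(2702/100) k⁻⁴`, `37 k⁻¹⁰`).

The finite parts are sums of finitely many layer sums / registry couplings at the rational points
`s = 2k²/3`; their certified enclosures are `…NumJ3a/b`, `…NumL3`, `…Num6`, the assembly is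
`HcpFccLatticeSumsCertificate.lean`.  [folklore]
-/

noncomputable section

namespace Literature.MathematicalPhysics.StatisticalMechanics.StackingSums

open Finset

/-! ## The stacking-difference family at the ideal ratio -/

/-- The signed registry family `g⁽ⁿ⁾(k) = ([3 ∤ k] − [2 ∤ k]) · J⁽ⁿ⁾(2k²/3)` is even. [folklore] -/
theorem diffFamily_even (n : ℕ) (t : ℝ) (k : ℤ) :
    ((if (-k) % 3 = 0 then (0 : ℝ) else 1) - (if (-k) % 2 = 0 then (0 : ℝ) else 1)) *
        registryCoupling n (((-k : ℤ) : ℝ) ^ 2 * t) =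
      ((if k % 3 = 0 then (0 : ℝ) else 1) - (if k % 2 = 0 then (0 : ℝ) else 1)) *
        registryCoupling n ((k : ℝ) ^ 2 * t) := by
  have h3 : (-k) % 3 = 0 ↔ k % 3 = 0 := by omega
  have h2 : (-k) % 2 = 0 ↔ k % 2 = 0 := by omega
  simp only [h3, h2, Int.cast_neg, neg_sq]

/-- Its coefficient has absolute value at most `1`. [folklore] -/
theorem diffCoeff_abs_le_one (k : ℤ) :
    |(if k % 3 = 0 then (0 : ℝ) else 1) - (if k % 2 = 0 then (0 : ℝ) else 1)| ≤ 1 := by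
  split_ifs <;> norm_num

/-- **Tail majorant, `n = 3`**: for `|k| ≥ 41`, `|g⁽³⁾(k)| ≤ (3106/25) k⁻⁶`
(`(207/20)(81/(16·41²) + (32/9)(27/8)) ≤ 3106/25`). [folklore] -/
theorem abs_diffFamily_three_le {k : ℤ} (hk : 41 ≤ k) :
    |((if k % 3 = 0 then (0 : ℝ) else 1) - (if k % 2 = 0 then (0 : ℝ) else 1)) *
        registryCoupling 3 ((k : ℝ) ^ 2 * (2 / 3))| ≤ 3106 / 25 * ((k : ℝ)⁻¹) ^ 6 := by
  have hk' : (41 : ℝ) ≤ k := by exact_mod_cast hk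
  have hkpos : (0 : ℝ) < k := by linarith
  set s : ℝ := (k : ℝ) ^ 2 * (2 / 3) with hs
  have hs320 : 320 ≤ s := by rw [hs]; nlinarith
  have hJ := registryCoupling_three_abs hs320
  rw [abs_mul]
  have hc := diffCoeff_abs_le_one k
  have hJ0 : 0 ≤ |registryCoupling 3 s| := abs_nonneg _
  calc |(if k % 3 = 0 then (0 : ℝ) else 1) - (if k % 2 = 0 then (0 : ℝ) else 1)| * |registryCoupling 3 s|
      ≤ 1 * |registryCoupling 3 s| := mul_le_mul_of_nonneg_right hc hJ0
    _ ≤ 207 / 20 * ((s⁻¹) ^ 4 + 32 / 9 * (s⁻¹) ^ 3) := by rw [one_mul]; exact hJ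
    _ ≤ 3106 / 25 * ((k : ℝ)⁻¹) ^ 6 := by
        have e3 : (s⁻¹) ^ 3 = 27 / 8 * ((k : ℝ)⁻¹) ^ 6 := by
          rw [hs, mul_inv, mul_pow, ← inv_pow, ← pow_mul]; norm_num; ring
        have hsi : s⁻¹ ≤ 3 / 2 * (1 / 41) ^ 2 := by
          rw [hs, mul_inv]
          have : ((k : ℝ) ^ 2)⁻¹ ≤ (1 / 41) ^ 2 := by
            rw [← inv_pow, one_div]
            exact pow_le_pow_left₀ (by positivity) (inv_anti₀ (by norm_num) hk') 2
          nlinarith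
        have e4 : (s⁻¹) ^ 4 = s⁻¹ * (s⁻¹) ^ 3 := by ring
        have h6 : 0 ≤ ((k : ℝ)⁻¹) ^ 6 := by positivity
        rw [e4, e3]
        nlinarith [mul_le_mul_of_nonneg_right hsi (by positivity : (0:ℝ) ≤ 27 / 8 * ((k : ℝ)⁻¹) ^ 6)]

/-- **Tail sum, `n = 3`, `K = 40`**: `∑_{m<N} |g⁽³⁾(m+41)| ≤ 3106/25 · (1/5) · 40⁻⁵`. [folklore] -/
theorem sum_abs_diffFamily_three_le (N : ℕ) :
    ∑ m ∈ range N, |((if (((m + 40 + 1 : ℕ) : ℤ)) % 3 = 0 then (0 : ℝ) else 1) -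
        (if (((m + 40 + 1 : ℕ) : ℤ)) % 2 = 0 then (0 : ℝ) else 1)) *
        registryCoupling 3 ((((m + 40 + 1 : ℕ) : ℤ) : ℝ) ^ 2 * (2 / 3))| ≤
      3106 / 25 * (1 / 5 * ((40 : ℝ)⁻¹) ^ 5) := by
  have hterm : ∀ m ∈ range N, |((if (((m + 40 + 1 : ℕ) : ℤ)) % 3 = 0 then (0 : ℝ) else 1) -
        (if (((m + 40 + 1 : ℕ) : ℤ)) % 2 = 0 then (0 : ℝ) else 1)) *
        registryCoupling 3 ((((m + 40 + 1 : ℕ) : ℤ) : ℝ) ^ 2 * (2 / 3))| ≤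
      3106 / 25 * ((((m + 40 + 1 : ℕ) : ℝ))⁻¹) ^ 6 := by
    intro m _
    have h := abs_diffFamily_three_le (k := ((m + 40 + 1 : ℕ) : ℤ)) (by omega)
    have e : (((m + 40 + 1 : ℕ) : ℤ) : ℝ) = ((m + 40 + 1 : ℕ) : ℝ) := by push_cast; ring
    rw [e] at h
    exact h
  refine (sum_le_sum hterm).trans ?_
  rw [← mul_sum]
  refine mul_le_mul_of_nonneg_left ?_ (by norm_num)
  have := sum_inv_pow_Ioc_le (d := 5) (by norm_num) (K := 40) (by norm_num) N
  norm_num at this ⊢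
  exact this

/-- **Tail majorant, `n = 6`**: for `k ≥ 13`, `|g⁽⁶⁾(k)| ≤ 1291 k⁻¹²`
(`(317/5)(3/(2·13²) + 16/9)(3/2)⁶ ≤ 1291`). [folklore] -/
theorem abs_diffFamily_six_le {k : ℤ} (hk : 13 ≤ k) :
    |((if k % 3 = 0 then (0 : ℝ) else 1) - (if k % 2 = 0 then (0 : ℝ) else 1)) *
        registryCoupling 6 ((k : ℝ) ^ 2 * (2 / 3))| ≤ 1291 * ((k : ℝ)⁻¹) ^ 12 := by
  have hk' : (13 : ℝ) ≤ k := by exact_mod_cast hk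
  have hkpos : (0 : ℝ) < k := by linarith
  set s : ℝ := (k : ℝ) ^ 2 * (2 / 3) with hs
  have hs100 : 100 ≤ s := by rw [hs]; nlinarith
  have hJ := registryCoupling_six_abs hs100
  rw [abs_mul]
  have hc := diffCoeff_abs_le_one k
  have hJ0 : 0 ≤ |registryCoupling 6 s| := abs_nonneg _
  calc |(if k % 3 = 0 then (0 : ℝ) else 1) - (if k % 2 = 0 then (0 : ℝ) else 1)| * |registryCoupling 6 s|
      ≤ 1 * |registryCoupling 6 s| := mul_le_mul_of_nonneg_right hc hJ0
    _ ≤ 317 / 5 * ((s⁻¹) ^ 7 + 16 / 9 * (s⁻¹) ^ 6) := by rw [one_mul]; exact hJ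
    _ ≤ 1291 * ((k : ℝ)⁻¹) ^ 12 := by
        have e6 : (s⁻¹) ^ 6 = 729 / 64 * ((k : ℝ)⁻¹) ^ 12 := by
          rw [hs, mul_inv, mul_pow, ← inv_pow, ← pow_mul]; norm_num; ring
        have hsi : s⁻¹ ≤ 3 / 2 * (1 / 13) ^ 2 := by
          rw [hs, mul_inv]
          have : ((k : ℝ) ^ 2)⁻¹ ≤ (1 / 13) ^ 2 := by
            rw [← inv_pow, one_div]
            exact pow_le_pow_left₀ (by positivity) (inv_anti₀ (by norm_num) hk') 2
          nlinarith
        have e7 : (s⁻¹) ^ 7 = s⁻¹ * (s⁻¹) ^ 6 := by ring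
        have h12 : 0 ≤ ((k : ℝ)⁻¹) ^ 12 := by positivity
        rw [e7, e6]
        nlinarith [mul_le_mul_of_nonneg_right hsi (by positivity : (0:ℝ) ≤ 729 / 64 * ((k : ℝ)⁻¹) ^ 12)]

/-- **Tail sum, `n = 6`, `K = 12`**: `∑_{m<N} |g⁽⁶⁾(m+13)| ≤ 1291 · (1/11) · 12⁻¹¹`. [folklore] -/
theorem sum_abs_diffFamily_six_le (N : ℕ) :
    ∑ m ∈ range N, |((if (((m + 12 + 1 : ℕ) : ℤ)) % 3 = 0 then (0 : ℝ) else 1) -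
        (if (((m + 12 + 1 : ℕ) : ℤ)) % 2 = 0 then (0 : ℝ) else 1)) *
        registryCoupling 6 ((((m + 12 + 1 : ℕ) : ℤ) : ℝ) ^ 2 * (2 / 3))| ≤
      1291 * (1 / 11 * ((12 : ℝ)⁻¹) ^ 11) := by
  have hterm : ∀ m ∈ range N, |((if (((m + 12 + 1 : ℕ) : ℤ)) % 3 = 0 then (0 : ℝ) else 1) -
        (if (((m + 12 + 1 : ℕ) : ℤ)) % 2 = 0 then (0 : ℝ) else 1)) *
        registryCoupling 6 ((((m + 12 + 1 : ℕ) : ℤ) : ℝ) ^ 2 * (2 / 3))| ≤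
      1291 * ((((m + 12 + 1 : ℕ) : ℝ))⁻¹) ^ 12 := by
    intro m _
    have h := abs_diffFamily_six_le (k := ((m + 12 + 1 : ℕ) : ℤ)) (by omega)
    have e : (((m + 12 + 1 : ℕ) : ℤ) : ℝ) = ((m + 12 + 1 : ℕ) : ℝ) := by push_cast; ring
    rw [e] at h
    exact h
  refine (sum_le_sum hterm).trans ?_
  rw [← mul_sum]
  refine mul_le_mul_of_nonneg_left ?_ (by norm_num)
  have := sum_inv_pow_Ioc_le (d := 11) (by norm_num) (K := 12) (by norm_num) N
  norm_num at this ⊢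
  exact this

/-- **The stacking difference at the ideal ratio, truncated** (`n = 3`, `K = 40`):
`|D₃ − 2 ∑_{k=1}^{40} g⁽³⁾(k)| ≤ 2 · (3106/25)(1/5) 40⁻⁵`, `D₃ = hcpInvPowSum 3 √(2/3) − fccInvPowSum 3 √(2/3)`.
[folklore] -/
theorem hcp_sub_fcc_three_trunc :
    |(hcpInvPowSum 3 (Real.sqrt (2 / 3)) - fccInvPowSum 3 (Real.sqrt (2 / 3))) -
      2 * ∑ m ∈ range 40, ((if (((m + 1 : ℕ) : ℤ)) % 3 = 0 then (0 : ℝ) else 1) -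
        (if (((m + 1 : ℕ) : ℤ)) % 2 = 0 then (0 : ℝ) else 1)) *
        registryCoupling 3 ((((m + 1 : ℕ) : ℤ) : ℝ) ^ 2 * (2 / 3))| ≤
      2 * (3106 / 25 * (1 / 5 * ((40 : ℝ)⁻¹) ^ 5)) := by
  have hc : Real.sqrt (2 / 3) ≠ 0 := (Real.sqrt_pos.2 (by norm_num)).ne'
  have hc2 : Real.sqrt (2 / 3) ^ 2 = 2 / 3 := Real.sq_sqrt (by norm_num)
  obtain ⟨hsum, heq⟩ := hcp_sub_fcc_eq_tsum (n := 3) (by norm_num) hc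
  simp only [hc2] at hsum heq
  rw [heq]
  exact tsum_int_even_trunc hsum (fun k => diffFamily_even 3 (2 / 3) k) (by norm_num) 40
    sum_abs_diffFamily_three_le

/-- **The stacking difference at the ideal ratio, truncated** (`n = 6`, `K = 12`). [folklore] -/
theorem hcp_sub_fcc_six_trunc :
    |(hcpInvPowSum 6 (Real.sqrt (2 / 3)) - fccInvPowSum 6 (Real.sqrt (2 / 3))) -
      2 * ∑ m ∈ range 12, ((if (((m + 1 : ℕ) : ℤ)) % 3 = 0 then (0 : ℝ) else 1) -
        (if (((m + 1 : ℕ) : ℤ)) % 2 = 0 then (0 : ℝ) else 1)) *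
        registryCoupling 6 ((((m + 1 : ℕ) : ℤ) : ℝ) ^ 2 * (2 / 3))| ≤
      2 * (1291 * (1 / 11 * ((12 : ℝ)⁻¹) ^ 11)) := by
  have hc : Real.sqrt (2 / 3) ≠ 0 := (Real.sqrt_pos.2 (by norm_num)).ne'
  have hc2 : Real.sqrt (2 / 3) ^ 2 = 2 / 3 := Real.sq_sqrt (by norm_num)
  obtain ⟨hsum, heq⟩ := hcp_sub_fcc_eq_tsum (n := 6) (by norm_num) hc
  simp only [hc2] at hsum heq
  rw [heq]
  exact tsum_int_even_trunc hsum (fun k => diffFamily_even 6 (2 / 3) k) (by norm_num) 12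
    sum_abs_diffFamily_six_le

/-! ## The hcp lattice sums at the ideal ratio (crude two-sided truncation) -/

/-- The hcp layer family at the ideal ratio, with the parity pattern written by `k % 2`. [folklore] -/
theorem hcpInvPowSum_eq_tsum_layerSum' {n : ℕ} (hn : 2 ≤ n) :
    Summable (fun k : ℤ => layerSum (if k % 2 = 0 then 0 else 1) n ((k : ℝ) ^ 2 * (2 / 3))) ∧
    hcpInvPowSum n (Real.sqrt (2 / 3)) =
      ∑' k : ℤ, layerSum (if k % 2 = 0 then 0 else 1) n ((k : ℝ) ^ 2 * (2 / 3)) := by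
  have hc : Real.sqrt (2 / 3) ≠ 0 := (Real.sqrt_pos.2 (by norm_num)).ne'
  have hc2 : Real.sqrt (2 / 3) ^ 2 = 2 / 3 := Real.sq_sqrt (by norm_num)
  have h1 := hcpInvPowSum_eq_tsum_layerSum hn hc
  have h2 := summable_layerSum (p := fun k : ℤ => if Even k then 0 else 1) (fun k => pattern_le_one _) hn hc
  simp only [hc2, Int.even_iff] at h1 h2
  exact ⟨h2, h1⟩

/-- **Layer majorant, `n = 3`**: for `k ≥ 17`, `layerSum δ 3 (2k²/3) ≤ (2702/100) k⁻⁴` (`δ ≤ 1`;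
`(27/8)/17² + 27 ≤ 27.02`). [folklore] -/
theorem layerSum_three_le_of_ge {δ : ℕ} (hδ : δ ≤ 1) {k : ℤ} (hk : 17 ≤ k) :
    layerSum δ 3 ((k : ℝ) ^ 2 * (2 / 3)) ≤ 2702 / 100 * ((k : ℝ)⁻¹) ^ 4 := by
  have hk' : (17 : ℝ) ≤ k := by exact_mod_cast hk
  have hkpos : (0 : ℝ) < k := by linarith
  set s : ℝ := (k : ℝ) ^ 2 * (2 / 3) with hs
  have hsp : 0 < s := by positivity
  have h := layerSum_le_of_pos hδ hsp (d := 2) (by norm_num)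
  have hα : 8 / ((if δ = 0 then 3 / 4 else 1 / 3 : ℝ) * (2 : ℕ)) ≤ 12 := by
    split_ifs <;> norm_num
  have e2 : (s⁻¹) ^ 2 = 9 / 4 * ((k : ℝ)⁻¹) ^ 4 := by
    rw [hs, mul_inv, mul_pow, ← inv_pow, ← pow_mul]; norm_num; ring
  have hsi : s⁻¹ ≤ 3 / 2 * (1 / 17) ^ 2 := by
    rw [hs, mul_inv]
    have : ((k : ℝ) ^ 2)⁻¹ ≤ (1 / 17) ^ 2 := by
      rw [← inv_pow, one_div]
      exact pow_le_pow_left₀ (by positivity) (inv_anti₀ (by norm_num) hk') 2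
    nlinarith
  have e3 : (s⁻¹) ^ (2 + 1) = s⁻¹ * (s⁻¹) ^ 2 := by ring
  have h2 : 0 ≤ (s⁻¹) ^ 2 := by positivity
  rw [e3] at h
  have h4 : 0 ≤ ((k : ℝ)⁻¹) ^ 4 := by positivity
  calc layerSum δ 3 s ≤ s⁻¹ * (s⁻¹) ^ 2 + 8 / ((if δ = 0 then 3 / 4 else 1 / 3 : ℝ) * (2 : ℕ)) * (s⁻¹) ^ 2 := h
    _ ≤ 3 / 2 * (1 / 17) ^ 2 * (s⁻¹) ^ 2 + 12 * (s⁻¹) ^ 2 := by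
        nlinarith [mul_le_mul_of_nonneg_right hsi h2, mul_le_mul_of_nonneg_right hα h2]
    _ ≤ 2702 / 100 * ((k : ℝ)⁻¹) ^ 4 := by rw [e2]; nlinarith

/-- **Layer tail sum, `n = 3`, `K' = 16`**. [folklore] -/
theorem sum_layerSum_three_le (N : ℕ) :
    ∑ m ∈ range N, layerSum (if (((m + 16 + 1 : ℕ) : ℤ)) % 2 = 0 then 0 else 1) 3
        ((((m + 16 + 1 : ℕ) : ℤ) : ℝ) ^ 2 * (2 / 3)) ≤ 2702 / 100 * (1 / 3 * ((16 : ℝ)⁻¹) ^ 3) := by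
  have hterm : ∀ m ∈ range N, layerSum (if (((m + 16 + 1 : ℕ) : ℤ)) % 2 = 0 then 0 else 1) 3
        ((((m + 16 + 1 : ℕ) : ℤ) : ℝ) ^ 2 * (2 / 3)) ≤ 2702 / 100 * ((((m + 16 + 1 : ℕ) : ℝ))⁻¹) ^ 4 := by
    intro m _
    have h := layerSum_three_le_of_ge (pattern_le_one _) (k := ((m + 16 + 1 : ℕ) : ℤ)) (by omega)
      (δ := if (((m + 16 + 1 : ℕ) : ℤ)) % 2 = 0 then 0 else 1)
    have e : (((m + 16 + 1 : ℕ) : ℤ) : ℝ) = ((m + 16 + 1 : ℕ) : ℝ) := by push_cast; ring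
    rw [e] at h
    exact h
  refine (sum_le_sum hterm).trans ?_
  rw [← mul_sum]
  refine mul_le_mul_of_nonneg_left ?_ (by norm_num)
  have := sum_inv_pow_Ioc_le (d := 3) (by norm_num) (K := 16) (by norm_num) N
  norm_num at this ⊢
  exact this

/-- **Layer majorant, `n = 6`**: for `k ≥ 7`, `layerSum δ 6 (2k²/3) ≤ 37 k⁻¹⁰` (`δ ≤ 1`;
`(3/(2·49) + 24/5)(3/2)⁵ ≤ 37`). [folklore] -/
theorem layerSum_six_le_of_ge {δ : ℕ} (hδ : δ ≤ 1) {k : ℤ} (hk : 7 ≤ k) :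
    layerSum δ 6 ((k : ℝ) ^ 2 * (2 / 3)) ≤ 37 * ((k : ℝ)⁻¹) ^ 10 := by
  have hk' : (7 : ℝ) ≤ k := by exact_mod_cast hk
  have hkpos : (0 : ℝ) < k := by linarith
  set s : ℝ := (k : ℝ) ^ 2 * (2 / 3) with hs
  have hsp : 0 < s := by positivity
  have h := layerSum_le_of_pos hδ hsp (d := 5) (by norm_num)
  have hα : 8 / ((if δ = 0 then 3 / 4 else 1 / 3 : ℝ) * (5 : ℕ)) ≤ 24 / 5 := by
    split_ifs <;> norm_num
  have e5 : (s⁻¹) ^ 5 = 243 / 32 * ((k : ℝ)⁻¹) ^ 10 := by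
    rw [hs, mul_inv, mul_pow, ← inv_pow, ← pow_mul]; norm_num; ring
  have hsi : s⁻¹ ≤ 3 / 2 * (1 / 7) ^ 2 := by
    rw [hs, mul_inv]
    have : ((k : ℝ) ^ 2)⁻¹ ≤ (1 / 7) ^ 2 := by
      rw [← inv_pow, one_div]
      exact pow_le_pow_left₀ (by positivity) (inv_anti₀ (by norm_num) hk') 2
    nlinarith
  have e6 : (s⁻¹) ^ (5 + 1) = s⁻¹ * (s⁻¹) ^ 5 := by ring
  have h5 : 0 ≤ (s⁻¹) ^ 5 := by positivity
  rw [e6] at h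
  have h10 : 0 ≤ ((k : ℝ)⁻¹) ^ 10 := by positivity
  calc layerSum δ 6 s ≤ s⁻¹ * (s⁻¹) ^ 5 + 8 / ((if δ = 0 then 3 / 4 else 1 / 3 : ℝ) * (5 : ℕ)) * (s⁻¹) ^ 5 := h
    _ ≤ 3 / 2 * (1 / 7) ^ 2 * (s⁻¹) ^ 5 + 24 / 5 * (s⁻¹) ^ 5 := by
        nlinarith [mul_le_mul_of_nonneg_right hsi h5, mul_le_mul_of_nonneg_right hα h5]
    _ ≤ 37 * ((k : ℝ)⁻¹) ^ 10 := by rw [e5]; nlinarith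

/-- **Layer tail sum, `n = 6`, `K' = 6`**. [folklore] -/
theorem sum_layerSum_six_le (N : ℕ) :
    ∑ m ∈ range N, layerSum (if (((m + 6 + 1 : ℕ) : ℤ)) % 2 = 0 then 0 else 1) 6
        ((((m + 6 + 1 : ℕ) : ℤ) : ℝ) ^ 2 * (2 / 3)) ≤ 37 * (1 / 9 * ((6 : ℝ)⁻¹) ^ 9) := by
  have hterm : ∀ m ∈ range N, layerSum (if (((m + 6 + 1 : ℕ) : ℤ)) % 2 = 0 then 0 else 1) 6
        ((((m + 6 + 1 : ℕ) : ℤ) : ℝ) ^ 2 * (2 / 3)) ≤ 37 * ((((m + 6 + 1 : ℕ) : ℝ))⁻¹) ^ 10 := by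
    intro m _
    have h := layerSum_six_le_of_ge (pattern_le_one _) (k := ((m + 6 + 1 : ℕ) : ℤ)) (by omega)
      (δ := if (((m + 6 + 1 : ℕ) : ℤ)) % 2 = 0 then 0 else 1)
    have e : (((m + 6 + 1 : ℕ) : ℤ) : ℝ) = ((m + 6 + 1 : ℕ) : ℝ) := by push_cast; ring
    rw [e] at h
    exact h
  refine (sum_le_sum hterm).trans ?_
  rw [← mul_sum]
  refine mul_le_mul_of_nonneg_left ?_ (by norm_num)
  have := sum_inv_pow_Ioc_le (d := 9) (by norm_num) (K := 6) (by norm_num) N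
  norm_num at this ⊢
  exact this

/-- **The hcp sum `L₆ʰᶜᵖ` truncated** (`n = 3`, `K' = 16`). [folklore] -/
theorem hcpInvPowSum_three_trunc :
    layerSum 0 3 0 + 2 * ∑ m ∈ range 16, layerSum (if (((m + 1 : ℕ) : ℤ)) % 2 = 0 then 0 else 1) 3
        ((((m + 1 : ℕ) : ℤ) : ℝ) ^ 2 * (2 / 3)) ≤ hcpInvPowSum 3 (Real.sqrt (2 / 3)) ∧
    hcpInvPowSum 3 (Real.sqrt (2 / 3)) ≤
      layerSum 0 3 0 + 2 * ∑ m ∈ range 16, layerSum (if (((m + 1 : ℕ) : ℤ)) % 2 = 0 then 0 else 1) 3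
        ((((m + 1 : ℕ) : ℤ) : ℝ) ^ 2 * (2 / 3)) + 2 * (2702 / 100 * (1 / 3 * ((16 : ℝ)⁻¹) ^ 3)) := by
  obtain ⟨hsum, heq⟩ := hcpInvPowSum_eq_tsum_layerSum' (n := 3) (by norm_num)
  rw [heq]
  have h := tsum_int_even_trunc_nonneg hsum (fun k => ?_) (fun k => ?_) 16 sum_layerSum_three_le
  · simpa using h
  · have h2 : (-k) % 2 = 0 ↔ k % 2 = 0 := by omega
    simp only [h2, Int.cast_neg, neg_sq]
  · exact layerSum_nonneg (pattern_le_one _) _ (by positivity)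

/-- **The hcp sum `L₁₂ʰᶜᵖ` truncated** (`n = 6`, `K' = 6`). [folklore] -/
theorem hcpInvPowSum_six_trunc :
    layerSum 0 6 0 + 2 * ∑ m ∈ range 6, layerSum (if (((m + 1 : ℕ) : ℤ)) % 2 = 0 then 0 else 1) 6
        ((((m + 1 : ℕ) : ℤ) : ℝ) ^ 2 * (2 / 3)) ≤ hcpInvPowSum 6 (Real.sqrt (2 / 3)) ∧
    hcpInvPowSum 6 (Real.sqrt (2 / 3)) ≤
      layerSum 0 6 0 + 2 * ∑ m ∈ range 6, layerSum (if (((m + 1 : ℕ) : ℤ)) % 2 = 0 then 0 else 1) 6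
        ((((m + 1 : ℕ) : ℤ) : ℝ) ^ 2 * (2 / 3)) + 2 * (37 * (1 / 9 * ((6 : ℝ)⁻¹) ^ 9)) := by
  obtain ⟨hsum, heq⟩ := hcpInvPowSum_eq_tsum_layerSum' (n := 6) (by norm_num)
  rw [heq]
  have h := tsum_int_even_trunc_nonneg hsum (fun k => ?_) (fun k => ?_) 6 sum_layerSum_six_le
  · simpa using h
  · have h2 : (-k) % 2 = 0 ↔ k % 2 = 0 := by omega
    simp only [h2, Int.cast_neg, neg_sq]
  · exact layerSum_nonneg (pattern_le_one _) _ (by positivity)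

end Literature.MathematicalPhysics.StatisticalMechanics.StackingSums

end
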